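import Mathlib.AlgebraicGeometry.IdealSheaf.Functorial
import HarnessLib

/-!
# Lemmas on ideal sheaves: inverse images between affine schemes, principal ideals

Topic: `Literature/AlgebraicGeometry/Resolution`. General lemmas over Mathlib's
`Scheme.IdealSheafData` used by the blowing-up files of this topic (`BlowupsProofs.lean`,
`AffineBlowupCartier.lean`), all PROVED:

* `mem_nonZeroDivisors_of_inverse` — nonzerodivisors are preserved by ring isomorphisms;
  `comap_span_singleton_ringEquiv` — principal ideals under ring isomorphisms;
* `ideal_ofIdealTop_top`, `ideal_top_eq_ker_subschemeι` — bookkeeping on affine schemes;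
* `comap_ofIdealTop_of_isAffine` — **inverse image ideal sheaves between affine schemes**:
  `(ofIdealTop I₀).comap f = ofIdealTop (I₀ · Γ(X, ⊤))` (not in Mathlib; via the Galois
  connection `comap ⊣ map`, `ker_of_isAffine` and `pullback.condition`);
  `comap_ofIdealTop_SpecMap` — the same along `Spec φ`, through `ΓSpecIso`.

## Sources

* The Stacks Project, Tag 01WS (effective Cartier divisors are cut out by nonzerodivisors
  locally). [StacksProject]
-/

noncomputable section

open CategoryTheory CategoryTheory.Limits AlgebraicGeometry TopologicalSpace Opposite

namespace Literature.AlgebraicGeometry.Resolution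

universe u

/-! ## Ring-level helpers -/

/-- Nonzerodivisors map to nonzerodivisors under a ring homomorphism `φ` admitting a ring
homomorphism `ψ` with `ψ ∘ φ = id` and `φ ∘ ψ = id` (e.g. an isomorphism). [folklore] -/
theorem mem_nonZeroDivisors_of_inverse {A B : Type*} [CommRing A] [CommRing B] (φ : A →+* B)
    (ψ : B →+* A) (h₁ : ∀ a, ψ (φ a) = a) (h₂ : ∀ b, φ (ψ b) = b) {f : A}
    (hf : f ∈ nonZeroDivisors A) : φ f ∈ nonZeroDivisors B := by
  refine (mem_nonZeroDivisors_iff_right).mpr fun b hb => ?_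
  have : ψ b * f = 0 := by
    have := congrArg ψ hb
    rwa [map_mul, h₁, map_zero] at this
  have hb0 : ψ b = 0 := (mem_nonZeroDivisors_iff_right.mp hf) _ this
  rw [← h₂ b, hb0, map_zero]

/-- Pulling back a principal ideal along a ring isomorphism gives the principal ideal of the
preimage of the generator. [folklore] -/
theorem comap_span_singleton_ringEquiv {A B : Type*} [CommRing A] [CommRing B] (e : A ≃+* B)
    (g : B) : (Ideal.span {g}).comap e.toRingHom = Ideal.span {e.symm g} := by
  apply le_antisymm
  · intro y hy
    rw [Ideal.mem_comap] at hy
    obtain ⟨c, hc⟩ := Ideal.mem_span_singleton'.mp hy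
    have : y = e.symm c * e.symm g := by
      rw [← map_mul, hc]
      exact (e.symm_apply_apply y).symm
    rw [this]
    exact Ideal.mul_mem_left _ _ (Ideal.subset_span rfl)
  · rw [Ideal.span_le, Set.singleton_subset_iff, SetLike.mem_coe, Ideal.mem_comap]
    change e (e.symm g) ∈ Ideal.span {g}
    rw [e.apply_symm_apply]
    exact Ideal.subset_span rfl

/-! ## Inverse image ideal sheaves between affine schemes -/

open Scheme.IdealSheafData in
/-- For an affine scheme, the ideal of `ofIdealTop I₀` on `⊤` is `I₀`. [folklore] -/
theorem ideal_ofIdealTop_top {X : Scheme.{u}} [IsAffine X] (I₀ : Ideal Γ(X, ⊤)) :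
    (ofIdealTop I₀).ideal ⟨⊤, isAffineOpen_top X⟩ = I₀ := by
  rw [ofIdealTop_ideal]
  change I₀.map (X.presheaf.map (homOfLE (le_top : (⊤ : X.Opens) ≤ ⊤)).op).hom = I₀
  rw [show homOfLE (le_top : (⊤ : X.Opens) ≤ ⊤) = 𝟙 _ from Subsingleton.elim _ _, op_id,
    X.presheaf.map_id]
  exact Ideal.map_id _

open Scheme.IdealSheafData in
/-- On an affine scheme the top ideal of an ideal sheaf is the kernel of the restriction of
global sections to the closed subscheme. [folklore] -/
theorem ideal_top_eq_ker_subschemeι {X : Scheme.{u}} [IsAffine X] (J : X.IdealSheafData) :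
    J.ideal ⟨⊤, isAffineOpen_top X⟩ = RingHom.ker (J.subschemeι.appTop).hom :=
  (ker_subschemeι_app J ⟨⊤, isAffineOpen_top X⟩).symm

open Scheme.IdealSheafData in
/-- **Inverse image ideal sheaves between affine schemes**: for `f : X → Y` with `X`, `Y` affine
and an ideal `I₀ ⊆ Γ(Y, ⊤)`, the inverse image (`comap`) of the ideal sheaf of `I₀` is the ideal
sheaf of `I₀ · Γ(X, ⊤)` (both inclusions through the Galois connection `comap ⊣ map`, the
description `ker_of_isAffine` of kernels over affine targets, and `pullback.condition`).
[folklore] -/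
theorem comap_ofIdealTop_of_isAffine {X Y : Scheme.{u}} [IsAffine X] [IsAffine Y] (f : X ⟶ Y)
    (I₀ : Ideal Γ(Y, ⊤)) :
    (ofIdealTop I₀).comap f = ofIdealTop (I₀.map f.appTop.hom) := by
  apply le_antisymm
  · rw [← le_map_iff_comap_le, Scheme.IdealSheafData.map, Scheme.ker_of_isAffine]
    refine le_of_isAffine ?_
    rw [ideal_ofIdealTop_top, ideal_ofIdealTop_top]
    intro i hi
    rw [RingHom.mem_ker, Scheme.Hom.comp_appTop]
    change ((ofIdealTop (I₀.map f.appTop.hom)).subschemeι.appTop).hom (f.appTop.hom i) = 0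
    rw [← RingHom.mem_ker, ← ideal_top_eq_ker_subschemeι, ideal_ofIdealTop_top]
    exact Ideal.mem_map_of_mem _ hi
  · refine le_of_isAffine ?_
    rw [ideal_ofIdealTop_top, Scheme.IdealSheafData.comap, Scheme.Hom.ker_apply,
      Ideal.map_le_iff_le_comap]
    intro i hi
    rw [Ideal.mem_comap, RingHom.mem_ker]
    change ((pullback.fst f (ofIdealTop I₀).subschemeι).appTop).hom (f.appTop.hom i) = 0
    rw [← CommRingCat.comp_apply, ← Scheme.Hom.comp_appTop, pullback.condition,
      Scheme.Hom.comp_appTop, CommRingCat.comp_apply]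
    have : ((ofIdealTop I₀).subschemeι.appTop).hom i = 0 := by
      rw [← RingHom.mem_ker, ← ideal_top_eq_ker_subschemeι, ideal_ofIdealTop_top]
      exact hi
    rw [this, map_zero]

/-- The inverse image ideal sheaf along `Spec φ : Spec B → Spec A` of the ideal sheaf of
`I ⊆ A` is the ideal sheaf of `φ(I) · B` (everything transported through `ΓSpecIso`).
[folklore] -/
theorem comap_ofIdealTop_SpecMap {A B : Type u} [CommRing A] [CommRing B] (φ : A →+* B)
    (I : Ideal A) :
    (Scheme.IdealSheafData.ofIdealTop (I.map (Scheme.ΓSpecIso (.of A)).inv.hom)).comap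
        (Spec.map (CommRingCat.ofHom φ)) =
      Scheme.IdealSheafData.ofIdealTop ((I.map φ).map (Scheme.ΓSpecIso (.of B)).inv.hom) := by
  rw [comap_ofIdealTop_of_isAffine, Ideal.map_map, Ideal.map_map]
  congr 1
  congr 1
  have := Scheme.ΓSpecIso_inv_naturality (CommRingCat.ofHom φ)
  exact congrArg (fun f : CommRingCat.of A ⟶ _ => f.hom) this.symm

end Literature.AlgebraicGeometry.Resolution

end
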